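import Literature.Analysis.FluidPDE.KNSSMildDecayProofs
import Literature.Analysis.FluidPDE.AncientLPSLiouvilleMild
import Literature.Analysis.FluidPDE.OseenKernelLp
import Literature.Analysis.FluidPDE.AncientLPSLiouvilleBootstrap
import HarnessLib

/-!
# Bounded classical solutions with square-integrable slices are mild (KNSS Lemma 3.1 + energy)

Analysis/FluidPDE proof file (theorems only). A classical solution `(u, p)` of the unforced
Navier–Stokes system (`ν = 1`) on `ℝ³ × (a, b)` which is **bounded** on `ℝ³ × (a, T]` and whose
slices are **uniformly square integrable** there (`‖u(t)‖_{L²} ≤ K < ∞`; e.g. a Leray–Hopf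
classical solution near a Type-I blow-up time, where the Type-I rate bounds `u` and the energy
inequality bounds `‖u(t)‖_{L²}`) satisfies the Oseen integral equation
`u(t) = e^{(t−s)Δ}u(s) − B¹ₛ(u, u)(t)` pointwise for all `a < s < t < T`
(`mild_of_bounded_of_eLpNorm_two_le_of_lt`). This is the finite-energy twin of the tree's
`mild_of_rMulNorm_bounded_of_lt` (`KNSSMildDecayProofs.lean`: Koch–Nadirashvili–Seregin–Šverák
2009, Thm 6.1, mildness clause, where the parasitic drift is killed by decay at horizontal
infinity), and the proof is the same except for Step 3: by Lemma 3.1 in drift-mild form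
(`KNSS2009_weak_driftMild_holds`) `u = U + b(t)` a.e. with `U` drift-mild; at good times the
drift-free right-hand side `R_r(t′) = e^{(t′−r)Δ}u(r) − B¹_r(u,u)(t′)` is in `L²(ℝ³)` (the heat flow
contracts `L²`, `eLpNorm_heatExtension_le_holds`; Minkowski in time for the Duhamel term,
`eLpNorm_oseenDuhamel_one_le_lintegral`, with the `L²` slice bound of the Oseen slice operator,
`exists_eLpNorm_oseenSlice_le`, and `‖ |u| |u| ‖₂ ≤ L ‖u‖₂`), so the drift increment
`b(r₂) − b(r₁) = R_{r₂}(t′) − R_{r₁}(t′)`, a constant in `L²(ℝ³)`, vanishes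
(`eq_zero_of_eLpNorm_const_lt_top`); KNSS 2009, §1 p. 3: the parasitic solutions are excluded by
finite energy. Steps 1, 2, 4, 5 (time shift, representation at good times, continuity upgrade to
all pairs) are verbatim those of the template.

References: G. Koch, N. Nadirashvili, G. Seregin, V. Šverák, Acta Math. 203 (2009) =
arXiv:0709.3599, §1 p. 3, §3 Lemma 3.1, §4 (i). [KochNadirashviliSereginSverak2009]
-/

noncomputable section

open MeasureTheory Set Function Filter TopologicalSpace InnerProductSpace Metric
open _root_.Topology
open scoped ENNReal NNReal RealInnerProductSpace

namespace Literature.Analysis.FluidPDE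

/-- **Bounded classical solutions with uniformly square-integrable slices are Oseen-mild**
(KNSS 2009, Lemma 3.1 in drift-mild form + vanishing of the parasitic drift by finite energy,
§1 p. 3; module docstring): a classical solution on `ℝ³ × (a, b)` (`ν = 1`), bounded by `L` and
with `‖u(t)‖_{L²} ≤ K < ∞` on `(a, T]`, `T < b`, satisfies `u(t) = e^{(t-s)Δ}u(s) - B¹_s(u,u)(t)`
pointwise for all `a < s < t < T`. [cite: KochNadirashviliSereginSverak2009, §3 Lemma 3.1 and §1 p. 3 (arXiv:0709.3599)] -/
theorem mild_of_bounded_of_eLpNorm_two_le_of_lt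
    {a b T : ℝ} {u : ℝ → EuclideanSpace ℝ (Fin 3) → EuclideanSpace ℝ (Fin 3)}
    {p : ℝ → EuclideanSpace ℝ (Fin 3) → ℝ} (hcl : IsClassicalNSSolutionOn (Ioo a b) 1 0 u p)
    (haT : a < T) (hTb : T < b) {L : ℝ} (hL : ∀ t ∈ Ioc a T, ∀ x, ‖u t x‖ ≤ L) {K : ℝ≥0∞}
    (hKtop : K ≠ ∞) (hK : ∀ t ∈ Ioc a T, eLpNorm (u t) 2 volume ≤ K) {s t : ℝ} (has : a < s)
    (hst : s < t) (htT : t < T) (x : EuclideanSpace ℝ (Fin 3)) :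
    u t x = UnboundedOperators.heatExtension (u s) (t - s) x - oseenDuhamel 1 s u u t x := by
  -- ### Step 1: time translation and Lemma 3.1
  set a₁ : ℝ := (a + s) / 2 with ha₁
  have haa₁ : a < a₁ := by rw [ha₁]; linarith
  have ha₁s : a₁ < s := by rw [ha₁]; linarith
  set T₁ : ℝ := T - a₁ with hT₁
  have hT₁pos : 0 < T₁ := by rw [hT₁]; linarith
  set v : ℝ → EuclideanSpace ℝ (Fin 3) → EuclideanSpace ℝ (Fin 3) := fun r y => u (r + a₁) y with hv
  set q : ℝ → EuclideanSpace ℝ (Fin 3) → ℝ := fun r y => p (r + a₁) y with hq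
  have hL0 : 0 ≤ L := (norm_nonneg _).trans (hL T ⟨haT, le_rfl⟩ 0)
  -- `v` is classical on `(0, T₁)` (indeed on the translate of `(a, b)`)
  have hclv' : IsClassicalNSSolutionOn ((· + a₁) ⁻¹' Ioo a b) 1 0 v q := by
    have h := hcl.comp_add_right a₁
    exact h
  have hsubI : Ioo 0 T₁ ⊆ (· + a₁) ⁻¹' Ioo a b := by
    intro r hr
    simp only [mem_preimage, mem_Ioo]
    constructor <;> [linarith [hr.1]; (rw [hT₁] at hr; linarith [hr.2])]
  have hclv : IsClassicalNSSolutionOn (Ioo 0 T₁) 1 0 v q := hclv'.mono hsubI (uniqueDiffOn_Ioo 0 T₁)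
  -- bounds and decay for `v`
  have hmemIoc : ∀ r ∈ Ioo 0 T₁, r + a₁ ∈ Ioc a T := fun r hr =>
    ⟨by linarith [hr.1], by rw [hT₁] at hr; linarith [hr.2]⟩
  have hvL : ∀ r ∈ Ioo 0 T₁, ∀ y, ‖v r y‖ ≤ L := fun r hr y => hL _ (hmemIoc r hr) y
  have hvK : ∀ r ∈ Ioo 0 T₁, eLpNorm (v r) 2 volume ≤ K := fun r hr => hK _ (hmemIoc r hr)
  have hcontv : ContinuousOn (uncurry v) (Ioo 0 T₁ ×ˢ univ) := hclv.smooth_velocity.continuousOn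
  have hcontv_slice : ∀ r ∈ Ioo 0 T₁, Continuous (v r) := fun r hr =>
    (hclv.contDiff_velocity hr).continuous
  have hmeasv : ∀ {s₁ s₂ : ℝ}, 0 ≤ s₁ → s₂ ≤ T₁ → AEStronglyMeasurable (uncurry v)
      ((volume : Measure (ℝ × EuclideanSpace ℝ (Fin 3))).restrict (Ioo s₁ s₂ ×ˢ univ)) :=
    fun {s₁ s₂} h1 h2 => (hcontv.mono (prod_mono (Ioo_subset_Ioo h1 h2) subset_rfl)).aestronglyMeasurable
      (measurableSet_Ioo.prod MeasurableSet.univ)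
  -- Lemma 3.1
  have hweak : IsBoundedWeakNSSolutionOn (Ioo 0 T₁) isOpen_Ioo 1 v :=
    hclv.isBoundedWeakNSSolutionOn ⟨L, hvL⟩
  obtain ⟨N, hN⟩ := KNSS2009_weak_driftMild_holds L T₁ hT₁pos
  obtain ⟨U, bd, hUb, hae⟩ := hN hweak hvL
  -- the good times
  set G : Set ℝ := {r | r ∈ Ioo 0 T₁ ∧ v r =ᵐ[volume] fun y => U r y + bd r} with hGdef
  have hGae : ∀ᵐ r ∂((volume : Measure ℝ).restrict (Ioo 0 T₁)), r ∈ G := by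
    filter_upwards [hae, ae_restrict_mem measurableSet_Ioo] with r h1 h2
    exact ⟨h2, h1⟩
  -- ### Step 2: the representation with drift at good initial times
  -- the drift-free right-hand side
  set R : ℝ → ℝ → EuclideanSpace ℝ (Fin 3) → EuclideanSpace ℝ (Fin 3) := fun r t' y =>
    UnboundedOperators.heatExtension (v r) (t' - r) y - oseenDuhamel 1 r v v t' y with hRdef
  have hUslice : ∀ σ, Measurable (U σ) := fun σ =>
    hUb.measurable.comp (measurable_const.prodMk measurable_id)
  have hA : ∀ r ∈ G, ∀ t' : ℝ, r < t' → t' < T₁ → ∀ y, U t' y = R r t' y - bd r := by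
    intro r hr t' hrt' ht' y
    have hr0 : 0 < r := hr.1.1
    have hmild := hUb.mild r t' hr0 hrt' ht' y
    -- the caloric term
    have hcal : UnboundedOperators.heatExtension (U r) (t' - r) y =
        UnboundedOperators.heatExtension (v r) (t' - r) y - bd r := by
      have hae_r : U r =ᵐ[volume] fun z => v r z - bd r := by
        filter_upwards [hr.2] with z hz
        rw [hz]; abel
      rw [UnboundedOperators.heatExtension_congr_ae' hae_r,
        UnboundedOperators.heatExtension_sub_of_bound (hcontv_slice r hr.1) continuous_const
          (hvL r hr.1) (fun _ => le_rfl) (sub_pos.2 hrt') y,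
        UnboundedOperators.heatExtension_const _ (sub_pos.2 hrt') y]
    -- the Duhamel term through the bridge and the a.e. identification of the slices
    have hduh : driftDuhamel U bd r t' y = oseenDuhamel 1 r v v t' y := by
      have hNN : ∀ σ ∈ Ioo r t', ∀ z, ‖U σ z + bd σ‖ ≤ N + N := fun σ hσ z =>
        (norm_add_le _ _).trans (add_le_add (hUb.norm_le σ ⟨hr0.trans hσ.1, hσ.2.trans ht'⟩ z)
          (hUb.norm_drift_le σ))
      rw [driftDuhamel_eq_oseenDuhamel_drift (fun σ _ => hUslice σ) hNN hrt'.le y]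
      refine oseenDuhamel_congr_ae_slices ?_ y
      have hsub : Ioo r t' ⊆ Ioo 0 T₁ := Ioo_subset_Ioo hr0.le ht'.le
      filter_upwards [ae_restrict_of_ae_restrict_of_subset hsub hae] with σ hσ
      exact hσ.symm
    rw [hmild, hcal, hduh]
    simp only [hRdef]
    abel
  -- ### Step 3: the drift is constant on the good times
  -- continuity of the drift-free right-hand side in `y`
  have hRcont' : ∀ r ∈ Ioo 0 T₁, ∀ t' : ℝ, r < t' → t' ≤ T₁ → Continuous (R r t') := by
    intro r hr t' hrt' ht'
    have h1 : Continuous (UnboundedOperators.heatExtension (v r) (t' - r)) :=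
      (UnboundedOperators.contDiff_heatExtension_holds
        (UnboundedOperators.memLp_top_of_continuous_of_bound (hcontv_slice r hr) (hvL r hr)) le_top
        (sub_pos.2 hrt')).continuous
    have h2 : Continuous (oseenDuhamel 1 r v v t') :=
      continuous_oseenDuhamel_slice one_pos hL0 (hmeasv hr.1.le ht') (hmeasv hr.1.le ht')
        (fun τ hτ y => hvL τ ⟨hr.1.trans hτ.1, hτ.2.trans_le ht'⟩ y)
        (fun τ hτ y => hvL τ ⟨hr.1.trans hτ.1, hτ.2.trans_le ht'⟩ y) hrt' le_rfl
    exact h1.sub h2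
  -- a globally measurable representative of `v` on the window (zero outside)
  set W : ℝ → EuclideanSpace ℝ (Fin 3) → EuclideanSpace ℝ (Fin 3) := fun σ y =>
    if σ ∈ Ioo 0 T₁ then v σ y else 0 with hWdef
  have hWv : ∀ σ ∈ Ioo 0 T₁, W σ = v σ := fun σ hσ => by
    funext y; simp only [hWdef, if_pos hσ]
  have hWmeas : Measurable (uncurry W) := by
    have hs : MeasurableSet (Ioo (0 : ℝ) T₁ ×ˢ (univ : Set (EuclideanSpace ℝ (Fin 3)))) :=
      measurableSet_Ioo.prod MeasurableSet.univ
    refine measurable_of_restrict_of_restrict_compl hs ?_ ?_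
    · have h1 : (Ioo (0 : ℝ) T₁ ×ˢ (univ : Set (EuclideanSpace ℝ (Fin 3)))).restrict (uncurry W) =
          (Ioo (0 : ℝ) T₁ ×ˢ (univ : Set (EuclideanSpace ℝ (Fin 3)))).restrict (uncurry v) := by
        funext z
        obtain ⟨⟨σ, y⟩, hz⟩ := z
        simp only [restrict_apply, uncurry_apply_pair, hWdef, if_pos hz.1]
      rw [h1]
      exact hcontv.restrict.measurable
    · have h1 : (Ioo (0 : ℝ) T₁ ×ˢ (univ : Set (EuclideanSpace ℝ (Fin 3))))ᶜ.restrict (uncurry W) =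
          fun _ => 0 := by
        funext z
        obtain ⟨⟨σ, y⟩, hz⟩ := z
        have hσ : σ ∉ Ioo (0 : ℝ) T₁ := fun h => hz ⟨h, mem_univ y⟩
        simp only [restrict_apply, uncurry_apply_pair, hWdef, if_neg hσ]
      rw [h1]
      exact measurable_const
  -- the `L²` slice bound for the Oseen slice operator
  obtain ⟨C₂, hC₂0, hS₂⟩ := exists_eLpNorm_oseenSlice_le (E := EuclideanSpace ℝ (Fin 3))
    (p := 2) (q := 2) (by norm_num) (by norm_num) le_rfl
  have hexp : -(1 / 2 : ℝ) - (Module.finrank ℝ (EuclideanSpace ℝ (Fin 3)) : ℝ) / 2 *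
      (1 / (2 : ℝ≥0∞).toReal - 1 / (2 : ℝ≥0∞).toReal) = -(1 / 2 : ℝ) := by ring
  -- `R r t'` has finite `L²` norm for window times `r < t' ≤ T₁`
  have hRL2 : ∀ r ∈ Ioo 0 T₁, ∀ t' : ℝ, r < t' → t' ≤ T₁ → eLpNorm (R r t') 2 volume < ∞ := by
    intro r hr t' hrt' ht'
    -- the caloric part
    have hvmem : MemLp (v r) 2 volume :=
      ⟨(hcontv_slice r hr).aestronglyMeasurable, (hvK r hr).trans_lt hKtop.lt_top⟩
    have hcal : eLpNorm (UnboundedOperators.heatExtension (v r) (t' - r)) 2 volume ≤ K :=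
      (UnboundedOperators.eLpNorm_heatExtension_le_holds hvmem (by norm_num) (sub_pos.2 hrt')).trans
        (hvK r hr)
    -- the Duhamel part through the measurable representative
    have hsubI : Ioo r t' ⊆ Ioo 0 T₁ := Ioo_subset_Ioo hr.1.le ht'
    have hcongr : oseenDuhamel 1 r v v t' = oseenDuhamel 1 r W W t' := by
      funext y
      refine oseenDuhamel_congr_ae_slices ?_ y
      filter_upwards [ae_restrict_mem measurableSet_Ioo] with σ hσ
      rw [hWv σ (hsubI hσ)]
    have hslice : ∀ σ ∈ Ioo r t',
        eLpNorm (fun x => ∫ y, oseenKernel (t' - σ) (x - y) (W σ y) (W σ y)) 2 volume ≤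
          ENNReal.ofReal ((t' - σ) ^ (-(1 / 2 : ℝ))) * (ENNReal.ofReal (C₂ * L) * K) := by
      intro σ hσ
      have hσ0 : 0 < t' - σ := sub_pos.2 hσ.2
      have hσI : σ ∈ Ioo 0 T₁ := hsubI hσ
      have hWm : AEStronglyMeasurable (W σ) volume := by
        rw [hWv σ hσI]; exact (hcontv_slice σ hσI).aestronglyMeasurable
      have h1 := hS₂ hσ0 hWm hWm
      rw [hexp] at h1
      have h2 : eLpNorm (fun y => ‖W σ y‖ * ‖W σ y‖) 2 volume ≤ ENNReal.ofReal L * K := by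
        have hpt : ∀ᵐ y ∂(volume : Measure (EuclideanSpace ℝ (Fin 3))),
            ‖‖W σ y‖ * ‖W σ y‖‖ ≤ L.toNNReal * ‖W σ y‖ := by
          refine Eventually.of_forall fun y => ?_
          rw [norm_mul, norm_norm, hWv σ hσI, Real.coe_toNNReal L hL0]
          exact mul_le_mul_of_nonneg_right (hvL σ hσI y) (norm_nonneg _)
        refine (eLpNorm_le_nnreal_smul_eLpNorm_of_ae_le_mul hpt 2).trans ?_
        rw [ENNReal.smul_def, smul_eq_mul, hWv σ hσI]
        exact mul_le_mul' (le_of_eq rfl) (hvK σ hσI)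
      calc eLpNorm (fun x => ∫ y, oseenKernel (t' - σ) (x - y) (W σ y) (W σ y)) 2 volume
          ≤ ENNReal.ofReal (C₂ * (t' - σ) ^ (-(1 / 2 : ℝ))) *
              eLpNorm (fun y => ‖W σ y‖ * ‖W σ y‖) 2 volume := h1
        _ ≤ ENNReal.ofReal (C₂ * (t' - σ) ^ (-(1 / 2 : ℝ))) * (ENNReal.ofReal L * K) :=
            mul_le_mul_right h2 _
        _ = ENNReal.ofReal ((t' - σ) ^ (-(1 / 2 : ℝ))) * (ENNReal.ofReal (C₂ * L) * K) := by
            rw [ENNReal.ofReal_mul hC₂0, ENNReal.ofReal_mul hC₂0]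
            have : (0 : ℝ) ≤ (t' - σ) ^ (-(1 / 2 : ℝ)) := Real.rpow_nonneg hσ0.le _
            ring
    have hduh : eLpNorm (oseenDuhamel 1 r v v t') 2 volume < ∞ := by
      rw [hcongr]
      refine (eLpNorm_oseenDuhamel_one_le_lintegral hWmeas hWmeas (p := 2) (by norm_num)
        (by norm_num) r t').trans_lt ?_
      calc ∫⁻ σ in Ioo r t', eLpNorm (fun x => ∫ y, oseenKernel (t' - σ) (x - y) (W σ y) (W σ y)) 2 volume
          ≤ ∫⁻ σ in Ioo r t', ENNReal.ofReal ((t' - σ) ^ (-(1 / 2 : ℝ))) * (ENNReal.ofReal (C₂ * L) * K) :=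
            setLIntegral_mono' measurableSet_Ioo fun σ hσ => hslice σ hσ
        _ = (∫⁻ σ in Ioo r t', ENNReal.ofReal ((t' - σ) ^ (-(1 / 2 : ℝ)))) * (ENNReal.ofReal (C₂ * L) * K) :=
            lintegral_mul_const _ (measurable_ofReal_rpow_sub_left t' (1 / 2))
        _ ≤ ENNReal.ofReal ((t' - r) ^ (1 - 1 / 2 : ℝ) / (1 - 1 / 2)) * (ENNReal.ofReal (C₂ * L) * K) :=
            mul_le_mul_left (lintegral_Ioo_ofReal_rpow_neg_sub_le (γ := 1 / 2) (by norm_num) hrt'.le le_rfl) _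
        _ < ∞ := ENNReal.mul_lt_top ENNReal.ofReal_lt_top
            (ENNReal.mul_lt_top ENNReal.ofReal_lt_top hKtop.lt_top)
    -- assemble
    have hm1 : AEStronglyMeasurable (UnboundedOperators.heatExtension (v r) (t' - r)) volume :=
      (UnboundedOperators.contDiff_heatExtension_holds
        (UnboundedOperators.memLp_top_of_continuous_of_bound (hcontv_slice r hr) (hvL r hr)) le_top
        (sub_pos.2 hrt')).continuous.aestronglyMeasurable
    have hm2 : AEStronglyMeasurable (oseenDuhamel 1 r v v t') volume :=
      (continuous_oseenDuhamel_slice one_pos hL0 (hmeasv hr.1.le ht') (hmeasv hr.1.le ht')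
        (fun τ hτ y => hvL τ ⟨hr.1.trans hτ.1, hτ.2.trans_le ht'⟩ y)
        (fun τ hτ y => hvL τ ⟨hr.1.trans hτ.1, hτ.2.trans_le ht'⟩ y) hrt' le_rfl).aestronglyMeasurable
    calc eLpNorm (R r t') 2 volume
        ≤ eLpNorm (UnboundedOperators.heatExtension (v r) (t' - r)) 2 volume +
            eLpNorm (oseenDuhamel 1 r v v t') 2 volume := eLpNorm_sub_le hm1 hm2 (by norm_num)
      _ < ∞ := ENNReal.add_lt_top.2 ⟨hcal.trans_lt hKtop.lt_top, hduh⟩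
  have hB_lt : ∀ r₁ ∈ G, ∀ r₂ ∈ G, r₁ < r₂ → bd r₁ = bd r₂ := by
    intro r₁ hr₁ r₂ hr₂ h12
    set t' : ℝ := (r₂ + T₁) / 2 with ht'
    have h2t' : r₂ < t' := by rw [ht']; linarith [hr₂.1.2]
    have ht'T : t' < T₁ := by rw [ht']; linarith [hr₂.1.2]
    have h1t' : r₁ < t' := h12.trans h2t'
    have key : ∀ y, bd r₂ - bd r₁ = R r₂ t' y - R r₁ t' y := by
      intro y
      have e1 := hA r₁ hr₁ t' h1t' ht'T y
      have e2 := hA r₂ hr₂ t' h2t' ht'T y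
      rw [e1] at e2
      -- `e2 : R r₁ t' y - bd r₁ = R r₂ t' y - bd r₂`
      calc bd r₂ - bd r₁ = (R r₂ t' y - (R r₂ t' y - bd r₂)) - (R r₁ t' y - (R r₁ t' y - bd r₁)) := by abel
        _ = (R r₂ t' y - (R r₁ t' y - bd r₁)) - (R r₁ t' y - (R r₁ t' y - bd r₁)) := by rw [← e2]
        _ = R r₂ t' y - R r₁ t' y := by abel
    have hzero : bd r₂ - bd r₁ = 0 := by
      haveI : Nontrivial (EuclideanSpace ℝ (Fin 3)) := inferInstance
      refine eq_zero_of_eLpNorm_const_lt_top (E := EuclideanSpace ℝ (Fin 3)) (p := 2) (by norm_num)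
        (by norm_num) ?_
      have hfun : (fun _ : EuclideanSpace ℝ (Fin 3) => bd r₂ - bd r₁) = R r₂ t' - R r₁ t' := by
        funext y; rw [key y]; rfl
      rw [hfun]
      have hm : ∀ r ∈ Ioo 0 T₁, r < t' → AEStronglyMeasurable (R r t') volume := fun r hr hrt =>
        (hRcont' r hr t' hrt ht'T.le).aestronglyMeasurable
      calc eLpNorm (R r₂ t' - R r₁ t') 2 volume
          ≤ eLpNorm (R r₂ t') 2 volume + eLpNorm (R r₁ t') 2 volume :=
            eLpNorm_sub_le (hm r₂ hr₂.1 h2t') (hm r₁ hr₁.1 h1t') (by norm_num)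
        _ < ∞ := ENNReal.add_lt_top.2 ⟨hRL2 r₂ hr₂.1 t' h2t' ht'T.le, hRL2 r₁ hr₁.1 t' h1t' ht'T.le⟩
    exact (sub_eq_zero.1 hzero).symm
  have hB : ∀ r₁ ∈ G, ∀ r₂ ∈ G, bd r₁ = bd r₂ := by
    intro r₁ hr₁ r₂ hr₂
    rcases lt_trichotomy r₁ r₂ with h | h | h
    · exact hB_lt r₁ hr₁ r₂ hr₂ h
    · rw [h]
    · exact (hB_lt r₂ hr₂ r₁ hr₁ h).symm
  -- ### Step 4: good pairs
  have hRcont := hRcont'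
  have hC : ∀ r ∈ G, ∀ t' ∈ G, r < t' → ∀ y, v t' y = R r t' y := by
    intro r hr t' ht' hrt' y
    have hae' : v t' =ᵐ[volume] R r t' := by
      filter_upwards [ht'.2] with z hz
      rw [hz, hA r hr t' hrt' ht'.1.2 z, hB t' ht' r hr]
      abel
    have heq := (Continuous.ae_eq_iff_eq volume (hcontv_slice t' ht'.1) (hRcont r hr.1 t' hrt' ht'.1.2.le)).1 hae'
    exact congrFun heq y
  -- ### Step 5: all pairs
  -- (a) good initial time, any later time
  have hC' : ∀ r ∈ G, ∀ t' : ℝ, r < t' → t' < T₁ → ∀ y, v t' y = R r t' y := by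
    intro r hr t' hrt' ht'T y
    have hr0 : 0 < r := hr.1.1
    have hsub : v t' y - R r t' y = 0 := by
      refine eq_zero_of_forall_norm_le fun ε hε => ?_
      -- continuity of `v` in time at `(t', y)`
      have hvc : ContinuousAt (fun σ => v σ y) t' := by
        have hc : ContinuousAt (uncurry v) (t', y) :=
          hcontv.continuousAt ((isOpen_Ioo.prod isOpen_univ).mem_nhds ⟨⟨hr0.trans hrt', ht'T⟩, mem_univ _⟩)
        have hg : ContinuousAt (fun σ : ℝ => (σ, y)) t' :=
          (continuous_id.prodMk continuous_const).continuousAt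
        exact ContinuousAt.comp (g := uncurry v) (f := fun σ : ℝ => (σ, y)) hc hg
      have e1 : ∀ᶠ σ in 𝓝 t', ‖v σ y - v t' y‖ < ε / 3 := by
        have := (Metric.tendsto_nhds.1 hvc) (ε / 3) (by positivity)
        simpa only [dist_eq_norm] using this
      -- continuity of the caloric term in time
      have hcalc : ContinuousAt (fun σ => UnboundedOperators.heatExtension (v r) (σ - r) y) t' := by
        have hd := UnboundedOperators.hasDerivAt_heatExtension_time (sub_pos.2 hrt')
          (UnboundedOperators.memLp_top_of_continuous_of_bound (hcontv_slice r hr.1) (hvL r hr.1)) le_top y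
        have hg : ContinuousAt (fun σ : ℝ => σ - r) t' := (continuous_id.sub continuous_const).continuousAt
        exact ContinuousAt.comp (g := fun σ => UnboundedOperators.heatExtension (v r) σ y)
          (f := fun σ : ℝ => σ - r) hd.continuousAt hg
      have e2 : ∀ᶠ σ in 𝓝 t', ‖UnboundedOperators.heatExtension (v r) (σ - r) y -
          UnboundedOperators.heatExtension (v r) (t' - r) y‖ < ε / 3 := by
        have := (Metric.tendsto_nhds.1 hcalc) (ε / 3) (by positivity)
        simpa only [dist_eq_norm] using this
      -- continuity of the Duhamel term in time (uniform modulus)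
      obtain ⟨δ, hδ, hmod⟩ := exists_forall_norm_oseenDuhamel_sub_le (E := EuclideanSpace ℝ (Fin 3))
        one_pos hT₁pos hL0 (by positivity : (0 : ℝ) < ε / 3)
      have e3 : ∀ᶠ σ in 𝓝 t', σ < t' + δ := Iio_mem_nhds (by linarith)
      have e4 : ∀ᶠ σ in 𝓝 t', σ < T₁ := Iio_mem_nhds ht'T
      -- a good time slightly to the right of `t'`
      obtain ⟨ρ, hρ, hgood⟩ := Metric.eventually_nhds_iff.1 (e1.and (e2.and (e3.and e4)))
      have hρ' : 0 < min ρ (T₁ - t') := lt_min hρ (sub_pos.2 ht'T)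
      obtain ⟨σ, hσI, hσG⟩ := exists_mem_Ioo_of_ae_mem hGae (hr0.trans hrt').le
        (show t' < t' + min ρ (T₁ - t') / 2 by linarith)
        (by linarith [min_le_right ρ (T₁ - t')])
      have hσdist : dist σ t' < ρ := by
        rw [Real.dist_eq, abs_of_pos (sub_pos.2 hσI.1)]
        linarith [hσI.2, min_le_left ρ (T₁ - t')]
      obtain ⟨g1, g2, g3, g4⟩ := hgood hσdist
      have hvσ : v σ y = R r σ y := hC r hr σ hσG (hrt'.trans hσI.1) y
      -- the Duhamel increment between `t'` and `σ`
      have hduh : ‖oseenDuhamel 1 r v v σ y - oseenDuhamel 1 r v v t' y‖ ≤ ε / 3 :=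
        hmod (by linarith) (hmeasv hr0.le le_rfl) (hmeasv hr0.le le_rfl)
          (fun τ hτ z => hvL τ ⟨hr0.trans hτ.1, hτ.2⟩ z) (fun τ hτ z => hvL τ ⟨hr0.trans hτ.1, hτ.2⟩ z)
          hrt'.le hσI.1.le g4.le (by linarith [hσI.2, min_le_left ρ (T₁ - t')]) y
      have hRR : ‖R r σ y - R r t' y‖ ≤ ε / 3 + ε / 3 := by
        simp only [hRdef]
        calc _ = ‖(UnboundedOperators.heatExtension (v r) (σ - r) y -
              UnboundedOperators.heatExtension (v r) (t' - r) y) -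
            (oseenDuhamel 1 r v v σ y - oseenDuhamel 1 r v v t' y)‖ := by abel_nf
          _ ≤ ‖UnboundedOperators.heatExtension (v r) (σ - r) y -
              UnboundedOperators.heatExtension (v r) (t' - r) y‖ +
            ‖oseenDuhamel 1 r v v σ y - oseenDuhamel 1 r v v t' y‖ := norm_sub_le _ _
          _ ≤ ε / 3 + ε / 3 := add_le_add g2.le hduh
      have g1' : ‖v t' y - v σ y‖ ≤ ε / 3 := by rw [norm_sub_rev]; exact g1.le
      calc ‖v t' y - R r t' y‖ = ‖(v t' y - v σ y) + (R r σ y - R r t' y)‖ := by rw [hvσ]; abel_nf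
        _ ≤ ‖v t' y - v σ y‖ + ‖R r σ y - R r t' y‖ := norm_add_le _ _
        _ ≤ ε / 3 + (ε / 3 + ε / 3) := add_le_add g1' hRR
        _ = ε := by ring
    exact sub_eq_zero.1 hsub
  -- (b) any initial time
  have hE : ∀ r t' : ℝ, 0 < r → r < t' → t' < T₁ → ∀ y, v t' y = R r t' y := by
    intro r t' hr0 hrt' ht'T y
    have hsub : v t' y - R r t' y = 0 := by
      refine eq_zero_of_forall_norm_le fun ε hε => ?_
      have h1 : ContinuousAt (fun ρ => UnboundedOperators.heatExtension (v ρ) (t' - ρ) y) r :=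
        continuousAt_heatExtension_datum hcontv hvL hr0 (hrt'.trans ht'T) hrt' y
      have h2 : ContinuousAt (fun ρ => oseenDuhamel 1 ρ v v t' y) r :=
        continuousAt_oseenDuhamel_initialTime hcontv hL0 hvL hr0 hrt' ht'T.le y
      have hRc : ContinuousAt (fun ρ => R ρ t' y) r := h1.sub h2
      have e1 : ∀ᶠ ρ in 𝓝 r, ‖R ρ t' y - R r t' y‖ < ε := by
        have := (Metric.tendsto_nhds.1 hRc) ε hε
        simpa only [dist_eq_norm] using this
      obtain ⟨δ, hδ, hgood⟩ := Metric.eventually_nhds_iff.1 e1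
      have hδ' : 0 < min δ (t' - r) := lt_min hδ (sub_pos.2 hrt')
      obtain ⟨ρ, hρI, hρG⟩ := exists_mem_Ioo_of_ae_mem hGae hr0.le
        (show r < r + min δ (t' - r) / 2 by linarith) (by linarith [min_le_right δ (t' - r), ht'T])
      have hρdist : dist ρ r < δ := by
        rw [Real.dist_eq, abs_of_pos (sub_pos.2 hρI.1)]
        linarith [hρI.2, min_le_left δ (t' - r)]
      have hρt' : ρ < t' := by linarith [hρI.2, min_le_right δ (t' - r)]
      have hvρ : v t' y = R ρ t' y := hC' ρ hρG t' hρt' ht'T y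
      rw [hvρ]
      exact (hgood hρdist).le
    exact sub_eq_zero.1 hsub
  -- ### translate back
  have hr : 0 < s - a₁ := sub_pos.2 ha₁s
  have hrt : s - a₁ < t - a₁ := by linarith
  have htT₁ : t - a₁ < T₁ := by rw [hT₁]; linarith
  have key := hE (s - a₁) (t - a₁) hr hrt htT₁ x
  simp only [hRdef, hv, sub_add_cancel] at key
  rw [show t - a₁ - (s - a₁) = t - s by ring] at key
  rw [key, oseenDuhamel_translate 1 (s - a₁) a₁ u u (t - a₁) x, sub_add_cancel, sub_add_cancel]

end Literature.Analysis.FluidPDE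

end
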